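import Literature.AlgebraicGeometry.Resolution.GenericFormMissesFibreComponents
import Literature.AlgebraicGeometry.Resolution.FormsOnAffineCharts
import Literature.AlgebraicGeometry.Resolution.AffineChartFibres
import Literature.AlgebraicGeometry.Resolution.SmoothFibreChart
import HarnessLib

/-!
# Generic conditions on a form of degree `m`, chart by chart: missing a closed point, missing the components of all closed fibres

Topic: `Literature/AlgebraicGeometry/Resolution`. Pure proofs (no definition, no named fact):
the translation of the ring-theoretic genericity statement of
`GenericFormMissesFibreComponents.lean` (de Jong 1996, proof of Lemma 4.13, pp. 69–70:
"`pr₁(T) ≠ 𝐏^∨`") and of "the hyperplane avoids a given point" into `IsGeneric` conditions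
(`GenericForms.lean`) on the coefficient vector `a` of the form `G_a = Σ a_μ x^μ` of degree `m`,
for a closed subscheme `r : X ↪ ℙⁿ_k` over an algebraically closed field `k`:

* `isGeneric_sectionsFun_notMem` — for a maximal ideal `𝔭` of the affine ring of a chart
  `X_i = r⁻¹D₊(xᵢ)`, generically the chart value `G_a(s)/s_i^m` does not lie in `𝔭`;
  `isGeneric_notMem_support` — generically `V(G_a(s))` avoids a given closed point;
* **`isGeneric_forall_notMem_minimalPrimes`** — for `f : X → Y` over `k` with all irreducible
  components of all fibres of dimension `1`, an affine open `U ⊆ Y` and a basic open chart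
  `W = (X_i)_h ⊆ f⁻¹(U)` with `dim Γ(X, W) ≤ e ≤ m`: generically, for every closed point
  `y' ∈ U` (maximal ideal `𝔫`) the chart value `G_a(s)/s_i^m|_W` lies in no minimal prime of
  `𝔫Γ(X, W)` — `V₊(G_a)` contains no irreducible component of the fibre `f⁻¹(y') ∩ W`
  (`exists_ne_zero_forall_sum_smul_notMem_minimalPrimes` with `dim Γ(W)/P = 1` from
  `ringKrullDim_quotient_eq_of_mem_minimalPrimes` and the span estimate
  `add_one_le_finrank_span_chartMonomial`). This is the chart-wise input `H` of
  `topologicalKrullDim_support_inter_preimage_le_zero` (`HypersurfaceSectionFibreDim.lean`).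

## References

* A. J. de Jong, *Smoothness, semi-stability and alterations*, Publ. Math. IHÉS 83 (1996),
  Lemma 4.13 (proof), pp. 69–70. [DeJong1996]
* R. Hartshorne, *Algebraic Geometry*, GTM 52 (1977), II Prop. 7.2. [Hartshorne1977]
-/

noncomputable section

universe u

open CategoryTheory AlgebraicGeometry Limits TopologicalSpace Opposite
open MvPolynomial (X C)
open Literature.AlgebraicGeometry.Motives Literature.AlgebraicGeometry.Motives.Segre
  Literature.AlgebraicGeometry.Motives.GeneratingSections

attribute [local instance] MvPolynomial.gradedAlgebra

namespace Literature.AlgebraicGeometry.Resolution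

/-! ### Avoiding a closed point -/

section Point

variable {k : Type u} [Field k] [IsAlgClosed k] {Z : SchemeOver k} {n : ℕ}
  (ι : Z ⟶ projectiveSpace n k) [IsClosedImmersion ι.left] [LocallyOfFiniteType Z.hom]

attribute [local instance] FieldNorm.secAlgebra

omit [IsAlgClosed k] [IsClosedImmersion ι.left] in
/-- `Γ(X, V)` is a finitely generated `k`-algebra for an affine open `V` of a `k`-scheme `X`
locally of finite type (Mathlib `HasRingHomProperty.appLE`). [folklore] -/
private theorem finiteType_sec' {V : Z.left.Opens} (hV : IsAffineOpen V) :
    Algebra.FiniteType k Γ(Z.left, V) := by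
  have h1 : (Z.hom.appLE ⊤ V le_top).hom.FiniteType :=
    HasRingHomProperty.appLE @LocallyOfFiniteType Z.hom inferInstance
      ⟨⊤, isAffineOpen_top _⟩ ⟨V, hV⟩ le_top
  have h2 : (Scheme.ΓSpecIso (.of k)).inv.hom.FiniteType :=
    RingHom.FiniteType.of_surjective _
      (Scheme.ΓSpecIso (.of k)).commRingCatIsoToRingEquiv.symm.surjective
  have h3 := RingHom.FiniteType.comp h1 h2
  rw [← CommRingCat.hom_comp] at h3
  exact h3

/-- **Generically, the chart value of the form misses a given closed point of the chart.** For a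
maximal ideal `𝔭` of `Γ(X, r⁻¹D₊(xᵢ))` (`X` locally of finite type over the algebraically closed
field `k`, so `Γ/𝔭 = k`), the coefficient vectors `a` with `G_a(s)/s_i^m = Σ a_μ c_μ ∉ 𝔭` are
generic: `Σ a_μ c_μ ≡ Σ a_μ c_μ(𝔭)` is a linear form in `a` with coefficient `c_{m eᵢ}(𝔭) = 1`
("the hyperplane does not pass through the point"). [cite: DeJong1996, Lemma 4.13 (proof), p. 70] -/
theorem isGeneric_sectionsFun_notMem (i : Fin (n + 1)) (m : ℕ)
    (𝔭 : Ideal Γ(Z.left, preU (emb ι) i)) (h𝔭 : 𝔭.IsMaximal) :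
    IsGeneric fun a : Monomials (Fin (n + 1)) m → k =>
      (ofHom (emb ι)).sectionsFun Z.hom i (formOfCoeffs a) ∉ 𝔭 := by
  classical
  haveI := h𝔭
  haveI : IsClosedImmersion (emb ι) := ‹_›
  haveI : Algebra.FiniteType k Γ(Z.left, preU (emb ι) i) :=
    finiteType_sec' (Z := Z) (isAffineOpen_ofHom_U (emb ι) i)
  -- the values `e_μ ∈ k` of the chart monomials at the point
  have he' := fun μ : Monomials (Fin (n + 1)) m =>
    Literature.RingTheory.KrullDimension.exists_sub_algebraMap_mem_of_isMaximal k 𝔭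
      (chartMonomial ι i m μ)
  choose e he using he'
  -- `e_{m eᵢ} = 1`
  have he1 : e (monoSelf i m) = 1 := by
    by_contra hne
    have h1 := he (monoSelf i m)
    rw [chartMonomial_monoSelf, ← (algebraMap k Γ(Z.left, preU (emb ι) i)).map_one, ← map_sub]
      at h1
    exact Ideal.IsPrime.ne_top inferInstance
      (Ideal.eq_top_of_isUnit_mem _ h1 ((IsUnit.mk0 _ (sub_ne_zero.mpr (Ne.symm hne))).map _))
  -- the linear form `Φ = Σ e_μ T_μ`
  refine ⟨∑ μ, MvPolynomial.C (e μ) * MvPolynomial.X μ, ?_, fun a ha hmem => ?_⟩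
  · intro h0
    have := congrArg (MvPolynomial.coeff (Finsupp.single (monoSelf i m) 1)) h0
    rw [MvPolynomial.coeff_sum, MvPolynomial.coeff_zero, Finset.sum_eq_single (monoSelf i m)] at this
    · rw [MvPolynomial.coeff_C_mul, MvPolynomial.coeff_X, if_pos rfl, mul_one, he1] at this
      exact one_ne_zero this
    · intro μ _ hμ
      rw [MvPolynomial.coeff_C_mul, MvPolynomial.coeff_X, if_neg, mul_zero]
      exact fun h' => hμ (Finsupp.single_left_injective one_ne_zero h')
    · intro h'; exact absurd (Finset.mem_univ _) h'
  · -- `Σ a_μ c_μ - Σ a_μ e_μ ∈ 𝔭`, so `Σ a_μ e_μ ∈ 𝔭`, a non-zero constant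
    apply ha
    set s : Γ(Z.left, preU (emb ι) i) := (ofHom (emb ι)).sectionsFun Z.hom i (formOfCoeffs a)
      with hs
    have hs' : s = ∑ μ, a μ • chartMonomial ι i m μ := by
      rw [hs, sectionsFun_formOfCoeffs]
    have hval : s - algebraMap k _ (∑ μ, a μ * e μ) ∈ 𝔭 := by
      have hsum : s - algebraMap k Γ(Z.left, preU (emb ι) i) (∑ μ, a μ * e μ) =
          ∑ μ, (a μ • chartMonomial ι i m μ - algebraMap k _ (a μ * e μ)) := by
        rw [hs', map_sum]
        exact (Finset.sum_sub_distrib _ _).symm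
      rw [hsum]
      refine Ideal.sum_mem _ fun μ _ => ?_
      rw [map_mul, Algebra.smul_def, ← mul_sub]
      exact Ideal.mul_mem_left _ _ (he μ)
    have hmem' : s ∈ 𝔭 := hmem
    have hc : algebraMap k _ (∑ μ, a μ * e μ) ∈ 𝔭 := (Submodule.sub_mem_iff_right 𝔭 hmem').mp hval
    by_contra hne
    have heval : MvPolynomial.eval a (∑ μ, MvPolynomial.C (e μ) * MvPolynomial.X μ) =
        ∑ μ, a μ * e μ := by
      simp only [map_sum, map_mul, MvPolynomial.eval_C, MvPolynomial.eval_X]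
      exact Finset.sum_congr rfl fun μ _ => mul_comm _ _
    rw [heval] at hne
    exact Ideal.IsPrime.ne_top inferInstance
      (Ideal.eq_top_of_isUnit_mem _ hc ((IsUnit.mk0 _ hne).map _))

/-- **Generically, the hypersurface section `X ∩ V₊(G_a)` avoids a given closed point.** For a
closed point `z` of `X` (`X ↪ ℙⁿ_k` closed, locally of finite type over the algebraically closed
`k`, quasi-separated) the coefficient vectors `a` with `z ∉ V(G_a(s))` are generic.
[cite: DeJong1996, Lemma 4.13 (proof), p. 70] -/
theorem isGeneric_notMem_support [QuasiSeparatedSpace Z.left] {m : ℕ} {z : Z.left}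
    (hz : IsClosed ({z} : Set Z.left)) :
    IsGeneric fun a : Monomials (Fin (n + 1)) m → k =>
      z ∉ (((ofHom (emb ι)).secOfForm Z.hom (formOfCoeffs a)
        (isHomogeneous_formOfCoeffs a)).zeroIdeal.support : Set Z.left) := by
  haveI : IsClosedImmersion (emb ι) := ‹_›
  -- a chart containing `z`
  obtain ⟨i, hzi⟩ : ∃ i, z ∈ (ofHom (emb ι)).U i := by
    have h : z ∈ (⨆ i, (ofHom (emb ι)).U i : Z.left.Opens) := by
      rw [(ofHom (emb ι)).iSup_U]; trivial
    exact Opens.mem_iSup.mp h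
  have hUi : IsAffineOpen (preU (emb ι) i) := isAffineOpen_ofHom_U (emb ι) i
  have hmax : (hUi.primeIdealOf ⟨z, hzi⟩).asIdeal.IsMaximal :=
    hUi.primeIdealOf_isMaximal_of_isClosed ⟨z, hzi⟩ hz
  refine (isGeneric_sectionsFun_notMem ι i m (hUi.primeIdealOf ⟨z, hzi⟩).asIdeal hmax).mono
    fun a ha hmem => ?_
  rw [SetLike.mem_coe, ((ofHom (emb ι)).secOfForm Z.hom (formOfCoeffs a)
    (isHomogeneous_formOfCoeffs a)).mem_support_zeroIdeal_iff (isAffineOpen_ofHom_U (emb ι)) hzi,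
    secOfForm_val] at hmem
  exact hmem ((FieldNorm.mem_basicOpen_iff_notMem_primeIdealOf hUi _ hzi).mpr ha)

end Point

/-! ### Missing the components of all closed fibres on a chart -/

section Fibres

variable {k : Type u} [Field k] [IsAlgClosed k] {Z : SchemeOver k} {n : ℕ}
  (ι : Z ⟶ projectiveSpace n k) [IsClosedImmersion ι.left] [LocallyOfFiniteType Z.hom]
  {Y : Scheme.{u}} (f : Z.left ⟶ Y) (g : Y ⟶ Spec (.of k)) [JacobsonSpace Y]

attribute [local instance] FieldNorm.secAlgebra

/-- **Generically, `V₊(G_a)` contains no irreducible component of any closed fibre in the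
chart.** Let `r : X ↪ ℙⁿ_k` be a closed immersion (`k` algebraically closed), `f : X → Y` a
`k`-morphism of `k`-schemes locally of finite type all of whose fibres have all their irreducible
components of dimension `1`, `U = Spec B ⊆ Y` an affine open, `W = (r⁻¹D₊(xᵢ))_h ⊆ f⁻¹(U)` a
basic open chart with `dim Γ(X, W) ≤ e ≤ m`. Then for generic coefficient vectors `a`
(`IsGeneric`), for every closed point `y'` of `U` (maximal ideal `𝔫 ⊆ B`) the chart value
`G_a(s)/s_i^m|_W` of the form `G_a = Σ a_μ x^μ` lies in no minimal prime of `𝔫Γ(X, W)`: de Jong's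
"`dim T ≤ dim Y + dim 𝐏^∨ - n` […] In particular, `pr₁(T) ≠ 𝐏^∨`", through
`exists_ne_zero_forall_sum_smul_notMem_minimalPrimes` (the components `V(P)` of the fibre are
curves, `ringKrullDim_quotient_eq_of_mem_minimalPrimes`, on which the chart monomials span
`≥ m + 1 ≥ e + 1` dimensions, `add_one_le_finrank_span_chartMonomial`).
[cite: DeJong1996, Lemma 4.13 (proof), pp. 69–70] -/
theorem isGeneric_forall_notMem_minimalPrimes (hf : f ≫ g = Z.hom)
    (hdim : ∀ (y : Y), ∀ C ∈ irreducibleComponents ↥(f.fiber y), topologicalKrullDim ↥C = 1)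
    {U : Y.Opens} (hU : IsAffineOpen U) (i : Fin (n + 1)) (h : Γ(Z.left, preU (emb ι) i))
    (hW : IsAffineOpen (Z.left.basicOpen h)) (hWU : Z.left.basicOpen h ≤ f ⁻¹ᵁ U) {m e : ℕ}
    (hem : e ≤ m) (hA : ringKrullDim Γ(Z.left, Z.left.basicOpen h) ≤ e) :
    IsGeneric fun a : Monomials (Fin (n + 1)) m → k =>
      ∀ 𝔫 : Ideal Γ(Y, U), 𝔫.IsMaximal →
        ∀ P ∈ (𝔫.map (f.appLE U (Z.left.basicOpen h) hWU).hom).minimalPrimes,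
          Z.left.presheaf.map (homOfLE (Z.left.basicOpen_le h)).op
            ((ofHom (emb ι)).sectionsFun Z.hom i (formOfCoeffs a)) ∉ P := by
  classical
  haveI : IsClosedImmersion (emb ι) := ‹_›
  -- `k`-algebra structures: `B = Γ(Y, U)` through `g`, `A = Γ(X, W)` through `Z.hom = f ≫ g`
  letI algB : Algebra k Γ(Y, U) := FieldNorm.secAlgebra (X := Over.mk g) U
  haveI : Algebra.FiniteType k Γ(Z.left, Z.left.basicOpen h) := finiteType_sec' (Z := Z) hW
  -- the chart map `φ = f^♯ : B → A` is a `k`-algebra map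
  let φ : Γ(Y, U) →ₐ[k] Γ(Z.left, Z.left.basicOpen h) :=
    { toRingHom := (f.appLE U (Z.left.basicOpen h) hWU).hom
      commutes' := fun c => by
        change (f.appLE U (Z.left.basicOpen h) hWU).hom
          (((Scheme.ΓSpecIso (.of k)).inv ≫ g.appLE ⊤ U le_top).hom c) =
          ((Scheme.ΓSpecIso (.of k)).inv ≫ Z.hom.appLE ⊤ (Z.left.basicOpen h) le_top).hom c
        rw [← CommRingCat.comp_apply, Category.assoc,
          Scheme.Hom.appLE_comp_appLE f g ⊤ U (Z.left.basicOpen h) le_top hWU, hf] }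
  have hφ : (φ : Γ(Y, U) →+* Γ(Z.left, Z.left.basicOpen h)) =
      (f.appLE U (Z.left.basicOpen h) hWU).hom := rfl
  -- the restriction `Γ(X_i) → Γ(W)` as a `k`-algebra map, and the chart values `c_μ|_W`
  let ρ : Γ(Z.left, preU (emb ι) i) →ₐ[k] Γ(Z.left, Z.left.basicOpen h) :=
    { toRingHom := (Z.left.presheaf.map (homOfLE (Z.left.basicOpen_le h)).op).hom
      commutes' := fun c => FieldNorm.map_algebraMap_sec (Z.left.basicOpen_le h) c }
  have hρ : ∀ b, ρ b = Z.left.presheaf.map (homOfLE (Z.left.basicOpen_le h)).op b := fun _ => rfl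
  set c : Monomials (Fin (n + 1)) m → Γ(Z.left, Z.left.basicOpen h) :=
    fun μ => ρ (chartMonomial ι i m μ) with hc
  have hval : ∀ a : Monomials (Fin (n + 1)) m → k,
      Z.left.presheaf.map (homOfLE (Z.left.basicOpen_le h)).op
        ((ofHom (emb ι)).sectionsFun Z.hom i (formOfCoeffs a)) = ∑ μ, a μ • c μ := by
    intro a
    rw [← hρ, sectionsFun_formOfCoeffs, map_sum]
    refine Finset.sum_congr rfl fun μ _ => ?_
    rw [map_smul]
  -- closed points of `U` ↔ maximal ideals of `B`
  have hdim' : ∀ 𝔫 : Ideal Γ(Y, U), 𝔫.IsMaximal →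
      ∀ P ∈ (𝔫.map (φ : Γ(Y, U) →+* Γ(Z.left, Z.left.basicOpen h))).minimalPrimes,
        ringKrullDim (Γ(Z.left, Z.left.basicOpen h) ⧸ P) = 1 := by
    intro 𝔫 h𝔫 P hP
    let q : PrimeSpectrum Γ(Y, U) := ⟨𝔫, h𝔫.isPrime⟩
    have hy' : IsClosed ({hU.fromSpec q} : Set Y) := isClosed_singleton_fromSpec_of_isMaximal hU q h𝔫
    have hyU : hU.fromSpec q ∈ U := fromSpec_mem hU q
    have hq : hU.primeIdealOf ⟨hU.fromSpec q, hyU⟩ = q := primeIdealOf_fromSpec hU q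
    have hP' : P ∈ ((hU.primeIdealOf ⟨hU.fromSpec q, hyU⟩).asIdeal.map
        (f.appLE U (Z.left.basicOpen h) hWU).hom).minimalPrimes := by
      rw [hq]; exact hP
    have := ringKrullDim_quotient_eq_of_mem_minimalPrimes f hU hW hWU Z.hom hyU hy'
      (hdim (hU.fromSpec q)) hP'
    exact_mod_cast this
  have hspan : ∀ 𝔫 : Ideal Γ(Y, U), 𝔫.IsMaximal →
      ∀ P ∈ (𝔫.map (φ : Γ(Y, U) →+* Γ(Z.left, Z.left.basicOpen h))).minimalPrimes,
        e + 1 ≤ Module.finrank k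
          (Submodule.span k (Set.range fun μ => Ideal.Quotient.mk P (c μ))) := by
    intro 𝔫 h𝔫 P hP
    haveI : P.IsPrime := hP.1.1
    have h1 : ringKrullDim (Γ(Z.left, Z.left.basicOpen h) ⧸ P) ≠ 0 := by
      rw [hdim' 𝔫 h𝔫 P hP]; exact one_ne_zero
    exact (Nat.add_le_add_right hem 1).trans (add_one_le_finrank_span_chartMonomial ι i h m P h1)
  obtain ⟨Φ, hΦ0, hΦ⟩ :=
    exists_ne_zero_forall_sum_smul_notMem_minimalPrimes k φ c e hA hdim' hspan
  refine ⟨Φ, hΦ0, fun a ha 𝔫 h𝔫 P hP => ?_⟩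
  rw [hval]
  exact hΦ a ha 𝔫 h𝔫 P (by rw [hφ]; exact hP)

end Fibres

end Literature.AlgebraicGeometry.Resolution

end
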